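import Literature.Barriers.RiemannHypothesis.TuranPartialSumsCriterion
import HarnessLib

/-!
# Sections of `ζ` beyond `σ = 1`: term data and the torus reduction for a box certificate

Barrier catalogue `Literature/Barriers/RiemannHypothesis/`, companion of `TuranPartialSums.lean` and
`TuranPartialSumsAssembly.lean`. This file prepares the certified computation
(`TuranPartialSumsBoxCert.lean`, Platt–Trudgian 2016, §2.2–§2.3) discharging the named fact
`PlattTrudgian2016_noZeros_sigma_ge_one` (`ζ_N(s) ≠ 0` for `Re s ≥ 1`,
`N ∈ {10, …, 18, 20, 21, 28}`):

* `BoxCert.Term`, `BoxCert.termOf`, `BoxCert.terms N`: every `n ≤ N` written as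
  `n = q · 2^a · 3^b · 5^c` with `q` coprime to the *core primes* (`2, 3`, and `5` when `N ≥ 25`);
  `BoxCert.G N q z₂ z₃ z₅ = Σ_{n ≤ N, q(n) = q} z₂^a z₃^b z₅^c` (the cofactor polynomials) and the
  exact identity `ζ_N(s) = Σ_q q^{-s} G_{N,q}(2^{-s}, 3^{-s}, 5^{-s})` (`zetaPartialSum_eq_sum_G`).
* The torus reduction: `BoxCert.Claim N` — for all `σ ∈ [1, 2]`, `θ₂ ∈ [0, π]`, `θ₃, θ₅ ∈ [0, 2π]`,
  with `z_p = p^{-σ} e^{iθ_p}`, `Σ_{q ≠ 1} q^{-σ} |G_{N,q}(z)| < |G_{N,1}(z)|` — implies `ζ_N(s) ≠ 0`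
  for `Re s ≥ 1` (`zetaPartialSum_ne_zero_of_claim`; `θ₂ ∈ [0, π]` by complex conjugation, `σ ≥ 2`
  by `zetaPartialSum_ne_zero_of_two_le_re`).
* The link with the general decomposition of `TuranPartialSumsCriterion.lean`
  (`twistedPartialSum_decomposition`, `smoothSum`, `bigCoeff`): `G_one_eq_smoothSum`,
  `cpow_mul_G_eq_bigCoeff`.

## Relation to the printed algorithm (Platt–Trudgian 2016, §2.2, p. 4)

The source treats the phases `θ_p = t log p` of the primes `p ≤ N` as independent variables and,
for `N = 28`, keeps FIVE box variables `σ, θ₂, θ₃, θ₅, θ₇`, bounds the groups of `11` and `13` by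
the cosine rule and removes only `17, 19, 23` (which occur once) by the triangle inequality; it
searches `σ ∈ (1, 1.73]` (Spira / Borwein–Fee–Ferguson–van der Waall). The formal text here
absorbs EVERY non-core cofactor group `q` by the triangle inequality — `q^{-σ}|G_{N,q}(z)|` is the
exact range of the `q`-group over its free phase (for `q = 11, 13` this is the source's cosine-rule
term; for `q = 7`, whose group is `1 + z₂ + z₃ + z₂²`, it eliminates `θ₇`) — so `Claim N` is, box
by box, a formally STRONGER inequality than the printed test (equivalent in truth value, the
`q`-phases being free, but it is THIS inequality that the certificate verifies), in dimension `4`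
(`N = 28`) or `3`; and `σ` runs over `[1, 2]` because the tree vendors only the elementary bound
`zetaPartialSum_ne_zero_of_two_le_re` (`σ ≥ 2`). `Claim N` is a predicate PROVED for each of the
twelve `N` in `TuranPartialSumsAssemblyCert.lean` (there is no named fact for it): one compiled
evaluation (`native_decide`) of the checker per `N`, whose auxiliary axiom (`Lean.ofReduceBool`)
the gate admits for proposals declared `computational`, as for `DeBrangesPositivityCert.lean` and
`MertensCertificate/Chunk*.lean`; a kernel evaluation of the same search (≈ `7.6·10⁴` boxes of
40-term second-order ball arithmetic at scale `2^28`) is out of reach of `decide`.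

## References

* [PlattTrudgian2016] D. J. Platt, T. S. Trudgian, *Zeroes of partial sums of the zeta-function*,
  LMS J. Comput. Math. 19 (2016), 37–41, §2.2–§2.3.
-/

open Complex

namespace Literature.Barriers.RiemannHypothesis

namespace BoxCert

/-! ## Term data -/

/-- Multiplicity of `p` in `n` (fuel-bounded recursion; exact for `fuel ≥ n`). [folklore] -/
def mult (p : ℕ) : ℕ → ℕ → ℕ
  | 0, _ => 0
  | fuel + 1, n => if n % p = 0 ∧ 0 < n ∧ 1 < p then mult p fuel (n / p) + 1 else 0

/-- A term `n = q · 2^a · 3^b · 5^c` of a section `ζ_N`: cofactor `q` and core exponents.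
[cite: PlattTrudgian2016, §2.2] -/
structure Term where
  /-- cofactor coprime to the core primes -/
  q : ℕ
  /-- exponent of `2` -/
  a : ℕ
  /-- exponent of `3` -/
  b : ℕ
  /-- exponent of `5` (zero unless `5` is a core prime) -/
  c : ℕ
  deriving DecidableEq, Repr, Inhabited

/-- The core part `2^a 3^b 5^c` of a term. [folklore] -/
def Term.smooth (t : Term) : ℕ := 2 ^ t.a * 3 ^ t.b * 5 ^ t.c

/-- The integer `n = q · 2^a 3^b 5^c` of a term. [folklore] -/
def Term.n (t : Term) : ℕ := t.q * t.smooth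

/-- Decomposition of `n` (`core5`: whether `5` is a core prime). [cite: PlattTrudgian2016, §2.2] -/
def termOf (core5 : Bool) (n : ℕ) : Term :=
  let a := mult 2 n n
  let b := mult 3 n n
  let c := if core5 then mult 5 n n else 0
  ⟨n / (2 ^ a * 3 ^ b * 5 ^ c), a, b, c⟩

/-- `5` is a core prime iff `25 ≤ N` (a prime `p` with `p² > N` occurs in `ζ_N` only to the first
power). [cite: PlattTrudgian2016, §2.2] -/
def core5 (N : ℕ) : Bool := decide (25 ≤ N)

/-- The terms of `ζ_N`, in the order `n = 1, …, N`. [cite: PlattTrudgian2016, §2.2] -/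
def terms (N : ℕ) : List Term := (List.range' 1 N).map (termOf (core5 N))

/-- The cofactors occurring in `ζ_N`, increasing (head `1`). [cite: PlattTrudgian2016, §2.2] -/
def qs (N : ℕ) : List ℕ := (List.range' 1 N).filter fun q ↦ q ∈ (terms N).map Term.q

/-- `termOf` decomposes every `1 ≤ n ≤ 28` correctly. [folklore] -/
theorem termOf_n : ∀ n ∈ List.range' 1 28, ∀ b : Bool, (termOf b n).n = n := by decide

/-- The term `n = 1`. [folklore] -/
theorem termOf_one (b : Bool) : termOf b 1 = ⟨1, 0, 0, 0⟩ := by cases b <;> decide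

/-- The monomial `z₂^a z₃^b z₅^c` of a term. [folklore] -/
noncomputable def Term.mono (t : Term) (z₂ z₃ z₅ : ℂ) : ℂ := z₂ ^ t.a * z₃ ^ t.b * z₅ ^ t.c

/-- The cofactor polynomial `G_{N,q}(z₂, z₃, z₅) = Σ_{n ≤ N, q(n) = q} z₂^a z₃^b z₅^c`.
[cite: PlattTrudgian2016, §2.2] -/
noncomputable def G (N q : ℕ) (z₂ z₃ z₅ : ℂ) : ℂ :=
  (((terms N).filter fun t ↦ t.q = q).map fun t ↦ t.mono z₂ z₃ z₅).sum

/-! ## The identity `ζ_N(s) = Σ_q q^{-s} G_{N,q}(2^{-s}, 3^{-s}, 5^{-s})` -/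

/-- `ζ_N(s)` as a list sum. [folklore] -/
theorem zetaPartialSum_eq_list_sum (N : ℕ) (s : ℂ) :
    zetaPartialSum N s = ((List.range' 1 N).map fun n : ℕ ↦ (n : ℂ) ^ (-s)).sum := by
  rw [zetaPartialSum, Nat.Icc_eq_range', Nat.add_sub_cancel]
  rfl

/-- `(q · 2^a 3^b 5^c)^{-s} = q^{-s} (2^{-s})^a (3^{-s})^b (5^{-s})^c`. [folklore] -/
theorem natCast_term_cpow (t : Term) (s : ℂ) :
    ((t.n : ℕ) : ℂ) ^ (-s) =
      (t.q : ℂ) ^ (-s) * t.mono ((2 : ℂ) ^ (-s)) ((3 : ℂ) ^ (-s)) ((5 : ℂ) ^ (-s)) := by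
  have hp : ∀ p k : ℕ, ((p ^ k : ℕ) : ℂ) ^ (-s) = ((p : ℂ) ^ (-s)) ^ k := fun p k ↦ by
    rw [Nat.cast_pow, ← natCast_cpow_natCast_mul, cpow_nat_mul]
  simp only [Term.n, Term.smooth, Term.mono]
  rw [Nat.cast_mul, natCast_mul_natCast_cpow, Nat.cast_mul, natCast_mul_natCast_cpow,
    Nat.cast_mul, natCast_mul_natCast_cpow, hp, hp, hp]
  push_cast
  ring

/-- A sum of `ite`s over a duplicate-free list picks out one value. [folklore] -/
theorem list_sum_map_ite_eq_of_nodup {β M : Type*} [DecidableEq β] [AddCommMonoid M]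
    (keys : List β) (hnd : keys.Nodup) (k₀ : β) (hk : k₀ ∈ keys) (v : M) :
    (keys.map fun k ↦ if k₀ = k then v else 0).sum = v := by
  induction keys with
  | nil => simp at hk
  | cons k ks ih =>
    rw [List.nodup_cons] at hnd
    rw [List.map_cons, List.sum_cons]
    by_cases h : k₀ = k
    · subst h
      have h0 : (ks.map fun k ↦ if k₀ = k then v else 0) = ks.map fun _ ↦ (0 : M) := by
        refine List.map_congr_left fun k hk' ↦ ?_
        rw [if_neg]
        rintro rfl
        exact hnd.1 hk'
      rw [h0, List.map_const', List.sum_replicate, smul_zero, if_pos rfl, add_zero]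
    · have hk' : k₀ ∈ ks := by
        rcases List.mem_cons.1 hk with h' | h'
        · exact absurd h' h
        · exact h'
      rw [if_neg h, zero_add, ih hnd.2 hk']

/-- Regrouping a list sum by a key. [folklore] -/
theorem list_sum_map_eq_sum_fibers {α β M : Type*} [DecidableEq β] [AddCommMonoid M]
    (l : List α) (key : α → β) (f : α → M) (keys : List β) (hnd : keys.Nodup)
    (hall : ∀ x ∈ l, key x ∈ keys) :
    (l.map f).sum = (keys.map fun k ↦ ((l.filter fun x ↦ key x = k).map f).sum).sum := by
  induction l with
  | nil => simp
  | cons x l ih =>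
    have hx : key x ∈ keys := hall x (by simp)
    have ih' := ih fun y hy ↦ hall y (by simp [hy])
    rw [List.map_cons, List.sum_cons, ih']
    have : (keys.map fun k ↦ (((x :: l).filter fun y ↦ key y = k).map f).sum) =
        keys.map fun k ↦ (if key x = k then f x else 0) +
          ((l.filter fun y ↦ key y = k).map f).sum := by
      refine List.map_congr_left fun k _ ↦ ?_
      by_cases h : key x = k
      · simp [h]
      · simp [h]
    rw [this, List.sum_map_add, list_sum_map_ite_eq_of_nodup keys hnd (key x) hx (f x)]

/-- `qs N` is duplicate free. [folklore] -/
theorem nodup_qs (N : ℕ) : (qs N).Nodup := (List.nodup_range' (step := 1) (by decide)).filter _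

/-- Every cofactor of a term of `ζ_N` (`N ≤ 28`) lies in `qs N`. [folklore] -/
theorem q_mem_qs {N : ℕ} (hN : N ≤ 28) {t : Term} (ht : t ∈ terms N) : t.q ∈ qs N := by
  simp only [terms, List.mem_map] at ht
  obtain ⟨n, hn, rfl⟩ := ht
  have hn' : n ∈ List.range' 1 28 := by
    rw [List.mem_range'_1] at hn ⊢; omega
  have hdec := termOf_n n hn' (core5 N)
  simp only [qs, List.mem_filter, List.mem_map, decide_eq_true_eq]
  refine ⟨?_, termOf (core5 N) n, List.mem_map.2 ⟨n, hn, rfl⟩, rfl⟩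
  -- `1 ≤ q ≤ n ≤ N`
  rw [List.mem_range'_1] at hn ⊢
  have hq : (termOf (core5 N) n).q * (termOf (core5 N) n).smooth = n := hdec
  have hs : 0 < (termOf (core5 N) n).smooth := by simp [Term.smooth]
  constructor
  · by_contra h0
    push Not at h0
    have : (termOf (core5 N) n).q = 0 := by omega
    rw [this, zero_mul] at hq
    omega
  · nlinarith

/-- The core part of a term is positive. [folklore] -/
theorem Term.smooth_pos (t : Term) : 0 < t.smooth := by
  simp [Term.smooth]

/-- Arithmetic of a term of `ζ_N` (`N ≤ 28`): `q · 2^a 3^b 5^c = n ∈ [1, N]`, so `1 ≤ q` and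
`2^a 3^b 5^c ≤ 28`. [folklore] -/
theorem mem_terms {N : ℕ} (hN : N ≤ 28) {t : Term} (ht : t ∈ terms N) :
    1 ≤ t.n ∧ t.n ≤ N ∧ 1 ≤ t.q ∧ 1 ≤ t.smooth ∧ t.smooth ≤ 28 := by
  simp only [terms, List.mem_map] at ht
  obtain ⟨n, hn, rfl⟩ := ht
  have hn' : n ∈ List.range' 1 28 := by
    rw [List.mem_range'_1] at hn ⊢; omega
  have hdec : (termOf (core5 N) n).q * (termOf (core5 N) n).smooth = n := termOf_n n hn' (core5 N)
  rw [List.mem_range'_1] at hn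
  have hs := (termOf (core5 N) n).smooth_pos
  have hq : 1 ≤ (termOf (core5 N) n).q := by
    by_contra h0
    push Not at h0
    have : (termOf (core5 N) n).q = 0 := by omega
    rw [this, zero_mul] at hdec
    omega
  refine ⟨by rw [Term.n, hdec]; omega, by rw [Term.n, hdec]; omega, hq, hs, ?_⟩
  nlinarith

/-- Cofactors lie in `[1, N]`. [folklore] -/
theorem mem_qs {N q : ℕ} (hq : q ∈ qs N) : 1 ≤ q ∧ q ≤ N := by
  simp only [qs, List.mem_filter, List.mem_range'_1] at hq
  omega

/-- `qs N = 1 :: (the cofactors ≠ 1)` for `N ≥ 1`. [folklore] -/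
theorem qs_eq_cons {N : ℕ} (hN1 : 1 ≤ N) : qs N = 1 :: (qs N).filter fun q ↦ q ≠ 1 := by
  have h1N : List.range' 1 N = 1 :: List.range' 2 (N - 1) := by
    obtain ⟨k, rfl⟩ : ∃ k, N = k + 1 := ⟨N - 1, by omega⟩
    simp [List.range'_succ]
  have hmem : (1 : ℕ) ∈ (terms N).map Term.q := by
    rw [terms, h1N, List.map_cons, List.map_cons, termOf_one]
    exact List.mem_cons_self
  rw [qs, h1N, List.filter_cons_of_pos (by simpa using hmem), List.filter_cons_of_neg (by simp),
    List.filter_filter]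
  congr 1
  refine List.filter_congr fun q hq ↦ ?_
  rw [List.mem_range'_1] at hq
  simp [show q ≠ 1 by omega]

/-- **The identity** `ζ_N(s) = Σ_{q ∈ qs N} q^{-s} · G_{N,q}(2^{-s}, 3^{-s}, 5^{-s})` (`N ≤ 28`).
[cite: PlattTrudgian2016, §2.2] -/
theorem zetaPartialSum_eq_sum_G {N : ℕ} (hN : N ≤ 28) (s : ℂ) :
    zetaPartialSum N s = ((qs N).map fun q : ℕ ↦
      (q : ℂ) ^ (-s) * G N q ((2 : ℂ) ^ (-s)) ((3 : ℂ) ^ (-s)) ((5 : ℂ) ^ (-s))).sum := by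
  -- rewrite each `n^{-s}` through its decomposition
  have h1 : ((List.range' 1 N).map fun n : ℕ ↦ (n : ℂ) ^ (-s)) =
      (terms N).map fun t ↦ (t.q : ℂ) ^ (-s) *
        t.mono ((2 : ℂ) ^ (-s)) ((3 : ℂ) ^ (-s)) ((5 : ℂ) ^ (-s)) := by
    rw [terms, List.map_map]
    refine List.map_congr_left fun n hn ↦ ?_
    have hn' : n ∈ List.range' 1 28 := by
      rw [List.mem_range'_1] at hn ⊢; omega
    have hdec := termOf_n n hn' (core5 N)
    simp only [Function.comp]
    rw [← natCast_term_cpow, hdec]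
  rw [zetaPartialSum_eq_list_sum, h1,
    list_sum_map_eq_sum_fibers (terms N) Term.q _ (qs N) (nodup_qs N) fun t ht ↦ q_mem_qs hN ht]
  refine congrArg List.sum (List.map_congr_left fun q _ ↦ ?_)
  rw [G, ← List.sum_map_mul_left]
  refine congrArg List.sum (List.map_congr_left fun t ht ↦ ?_)
  rw [List.mem_filter, decide_eq_true_eq] at ht
  rw [ht.2]

/-! ## The torus reduction -/

/-- `z_p(σ, θ) = p^{-σ} e^{iθ}`. [cite: PlattTrudgian2016, §2.2] -/
noncomputable def zOf (p : ℕ) (σ θ : ℝ) : ℂ := (((p : ℝ) ^ (-σ) : ℝ) : ℂ) * cexp (θ * I)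

/-- The free-prime remainder `R_N(σ, z) = Σ_{q ∈ qs N, q ≠ 1} q^{-σ} |G_{N,q}(z)|`.
[cite: PlattTrudgian2016, §2.2] -/
noncomputable def R (N : ℕ) (σ : ℝ) (z₂ z₃ z₅ : ℂ) : ℝ :=
  (((qs N).filter fun q ↦ q ≠ 1).map fun q : ℕ ↦ (q : ℝ) ^ (-σ) * ‖G N q z₂ z₃ z₅‖).sum

/-- **The claim to be certified** for `N` (a predicate, proved for each of the twelve `N` of (1.1)
in `TuranPartialSumsAssemblyCert.lean`; not a named fact): on `σ ∈ [1, 2]`, `θ₂ ∈ [0, π]`,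
`θ₃, θ₅ ∈ [0, 2π]`, with `z_p = p^{-σ} e^{iθ_p}`: `R_N(σ, z) < |G_{N,1}(z)|` — every non-core group
absorbed by the triangle inequality (see the module docstring for the relation to the printed
five-variable test). [cite: PlattTrudgian2016, §2.2–§2.3] -/
def Claim (N : ℕ) : Prop :=
  ∀ σ θ₂ θ₃ θ₅ : ℝ, 1 ≤ σ → σ ≤ 2 → 0 ≤ θ₂ → θ₂ ≤ Real.pi → 0 ≤ θ₃ → θ₃ ≤ 2 * Real.pi →
    0 ≤ θ₅ → θ₅ ≤ 2 * Real.pi →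
    R N σ (zOf 2 σ θ₂) (zOf 3 σ θ₃) (zOf 5 σ θ₅) < ‖G N 1 (zOf 2 σ θ₂) (zOf 3 σ θ₃) (zOf 5 σ θ₅)‖

/-- `p^{-s} = p^{-σ} · e^{-it log p}`. [folklore] -/
theorem natCast_cpow_neg_eq_zOf (p : ℕ) (hp : 0 < p) (s : ℂ) :
    (p : ℂ) ^ (-s) = zOf p s.re (-(s.im * Real.log p)) := by
  have hp' : (p : ℂ) ≠ 0 := by exact_mod_cast hp.ne'
  have hpr : (0 : ℝ) < p := by exact_mod_cast hp
  rw [zOf, cpow_def_of_ne_zero hp', ← natCast_log, Real.rpow_def_of_pos hpr, ofReal_exp,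
    ← Complex.exp_add]
  congr 1
  apply Complex.ext <;> simp <;> ring

/-- Conjugating the variables conjugates `G_{N,q}` (real coefficients). [folklore] -/
theorem G_conj (N q : ℕ) (z₂ z₃ z₅ : ℂ) :
    G N q (starRingEnd ℂ z₂) (starRingEnd ℂ z₃) (starRingEnd ℂ z₅) =
      starRingEnd ℂ (G N q z₂ z₃ z₅) := by
  rw [G, G, map_list_sum, List.map_map]
  refine congrArg List.sum (List.map_congr_left fun t _ ↦ ?_)
  simp [Function.comp, Term.mono, map_mul, map_pow]

/-- `conj (p^{-σ} e^{iθ}) = p^{-σ} e^{-iθ}`. [folklore] -/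
theorem conj_zOf (p : ℕ) (σ θ : ℝ) : starRingEnd ℂ (zOf p σ θ) = zOf p σ (-θ) := by
  rw [zOf, zOf, map_mul, conj_ofReal, ← exp_conj, map_mul, conj_ofReal, conj_I]
  push_cast
  ring_nf

/-- A unit complex number is `e^{iθ}` with `θ ∈ [0, 2π]`. [folklore] -/
theorem exists_angle_of_norm_eq_one {u : ℂ} (hu : ‖u‖ = 1) :
    ∃ θ : ℝ, 0 ≤ θ ∧ θ ≤ 2 * Real.pi ∧ cexp (θ * I) = u := by
  have key : cexp (arg u * I) = u := by
    have := norm_mul_exp_arg_mul_I u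
    rwa [hu, ofReal_one, one_mul] at this
  by_cases h : 0 ≤ arg u
  · exact ⟨arg u, h, (arg_le_pi u).trans (by linarith [Real.pi_pos]), key⟩
  · refine ⟨arg u + 2 * Real.pi, by linarith [neg_pi_lt_arg u], by linarith [arg_le_pi u], ?_⟩
    have e : ((arg u + 2 * Real.pi : ℝ) : ℂ) * I = arg u * I + 2 * Real.pi * I := by
      push_cast; ring
    rw [e, Complex.exp_add, exp_two_pi_mul_I, mul_one, key]

/-- A unit complex number in the closed upper half plane is `e^{iθ}` with `θ ∈ [0, π]`.
[folklore] -/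
theorem exists_angle_of_im_nonneg {u : ℂ} (hu : ‖u‖ = 1) (him : 0 ≤ u.im) :
    ∃ θ : ℝ, 0 ≤ θ ∧ θ ≤ Real.pi ∧ cexp (θ * I) = u := by
  have key : cexp (arg u * I) = u := by
    have := norm_mul_exp_arg_mul_I u
    rwa [hu, ofReal_one, one_mul] at this
  exact ⟨arg u, arg_nonneg_iff.2 him, arg_le_pi u, key⟩

/-- `zOf p σ θ` depends on `θ` only through `e^{iθ}`. [folklore] -/
theorem zOf_eq_of_exp_eq (p : ℕ) (σ : ℝ) {θ θ' : ℝ} (h : cexp (θ * I) = cexp (θ' * I)) :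
    zOf p σ θ = zOf p σ θ' := by
  rw [zOf, zOf, h]

/-- `|e^{iθ}| = 1`. [folklore] -/
theorem norm_exp_ofReal_mul_I' (θ : ℝ) : ‖cexp (θ * I)‖ = 1 := norm_exp_ofReal_mul_I θ

/-- `‖Σ l‖ ≤ Σ ‖·‖` for lists. [folklore] -/
theorem norm_list_sum_le' (l : List ℂ) : ‖l.sum‖ ≤ (l.map fun x ↦ ‖x‖).sum := by
  simpa using norm_multiset_sum_le (l : Multiset ℂ)

/-- `R_N` is invariant under conjugation of the variables. [folklore] -/
theorem R_conj (N : ℕ) (σ : ℝ) (z₂ z₃ z₅ : ℂ) :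
    R N σ (starRingEnd ℂ z₂) (starRingEnd ℂ z₃) (starRingEnd ℂ z₅) = R N σ z₂ z₃ z₅ := by
  unfold R
  refine congrArg List.sum (List.map_congr_left fun q _ ↦ ?_)
  rw [G_conj, Complex.norm_conj]

/-- `Claim N` extends from the fundamental domain to all real angles (periodicity in each `θ_p`,
and the conjugation symmetry `θ ↦ −θ`). [cite: PlattTrudgian2016, §2.2] -/
theorem Claim.extend {N : ℕ} (hC : Claim N) {σ : ℝ} (h1 : 1 ≤ σ) (h2 : σ ≤ 2) (θ₂ θ₃ θ₅ : ℝ) :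
    R N σ (zOf 2 σ θ₂) (zOf 3 σ θ₃) (zOf 5 σ θ₅) <
      ‖G N 1 (zOf 2 σ θ₂) (zOf 3 σ θ₃) (zOf 5 σ θ₅)‖ := by
  have hn : ∀ θ : ℝ, ‖cexp (θ * I)‖ = 1 := norm_exp_ofReal_mul_I
  by_cases him : 0 ≤ (cexp (θ₂ * I)).im
  · obtain ⟨φ₂, h20, h21, e2⟩ := exists_angle_of_im_nonneg (hn θ₂) him
    obtain ⟨φ₃, h30, h31, e3⟩ := exists_angle_of_norm_eq_one (hn θ₃)
    obtain ⟨φ₅, h50, h51, e5⟩ := exists_angle_of_norm_eq_one (hn θ₅)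
    have := hC σ φ₂ φ₃ φ₅ h1 h2 h20 h21 h30 h31 h50 h51
    rwa [zOf_eq_of_exp_eq 2 σ e2, zOf_eq_of_exp_eq 3 σ e3, zOf_eq_of_exp_eq 5 σ e5] at this
  · have hconj : ∀ θ : ℝ, cexp (↑(-θ) * I) = starRingEnd ℂ (cexp (θ * I)) := fun θ ↦ by
      rw [← exp_conj, map_mul, conj_ofReal, conj_I]
      push_cast
      ring_nf
    have him' : 0 ≤ (cexp (↑(-θ₂) * I)).im := by
      rw [hconj, conj_im]
      linarith [lt_of_not_ge him]
    obtain ⟨φ₂, h20, h21, e2⟩ := exists_angle_of_im_nonneg (hn (-θ₂)) him'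
    obtain ⟨φ₃, h30, h31, e3⟩ := exists_angle_of_norm_eq_one (hn (-θ₃))
    obtain ⟨φ₅, h50, h51, e5⟩ := exists_angle_of_norm_eq_one (hn (-θ₅))
    have := hC σ φ₂ φ₃ φ₅ h1 h2 h20 h21 h30 h31 h50 h51
    rwa [zOf_eq_of_exp_eq 2 σ e2, zOf_eq_of_exp_eq 3 σ e3, zOf_eq_of_exp_eq 5 σ e5,
      ← conj_zOf, ← conj_zOf, ← conj_zOf, R_conj, G_conj, Complex.norm_conj] at this

/-- **The torus reduction**: `Claim N` implies that `ζ_N` has no zero with `Re s ≥ 1`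
(`1 ≤ N ≤ 28`). Write `ζ_N(s) = G_1(z) + Σ_{q ≠ 1} q^{-s} G_q(z)` with `z_p = p^{-s} = p^{-σ} u_p`,
`|u_p| = 1`; after a complex conjugation (if `Im u₂ < 0`) the angles of `u₂, u₃, u₅` lie in the
domain of the claim, so `|ζ_N(s)| ≥ |G_1| − R > 0`; `σ ≥ 2` is `zetaPartialSum_ne_zero_of_two_le_re`.
[cite: PlattTrudgian2016, §2.2] -/
theorem zetaPartialSum_ne_zero_of_claim {N : ℕ} (hN1 : 1 ≤ N) (hN : N ≤ 28) (hC : Claim N)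
    {s : ℂ} (hs : 1 ≤ s.re) : zetaPartialSum N s ≠ 0 := by
  rcases le_or_gt 2 s.re with h2 | h2
  · exact zetaPartialSum_ne_zero_of_two_le_re hN1 h2
  set σ : ℝ := s.re with hσ
  -- the remainder bound `|ζ_N(s)| ≥ |G_1(z)| - R(σ, z)` for `z_p = p^{-s}`
  have hsplit : ∀ z₂ z₃ z₅ : ℂ,
      ‖((qs N).map fun q : ℕ ↦ (q : ℂ) ^ (-s) * G N q z₂ z₃ z₅).sum‖ ≥
        ‖G N 1 z₂ z₃ z₅‖ - R N σ z₂ z₃ z₅ := by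
    intro z₂ z₃ z₅
    rw [qs_eq_cons hN1, List.map_cons, List.sum_cons, Nat.cast_one, one_cpow, one_mul, R]
    have hR : ‖(((qs N).filter fun q ↦ q ≠ 1).map fun q : ℕ ↦
        (q : ℂ) ^ (-s) * G N q z₂ z₃ z₅).sum‖ ≤
        (((qs N).filter fun q ↦ q ≠ 1).map fun q : ℕ ↦ (q : ℝ) ^ (-σ) * ‖G N q z₂ z₃ z₅‖).sum := by
      refine (norm_list_sum_le' _).trans (le_of_eq ?_)
      rw [List.map_map]
      refine congrArg List.sum (List.map_congr_left fun q hq ↦ ?_)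
      have hq0 : 0 < q := by
        have := mem_qs (List.mem_filter.1 hq).1; omega
      simp [Function.comp, norm_natCast_cpow_of_pos hq0, ← hσ]
    have := norm_add_le_of_le (le_refl ‖G N 1 z₂ z₃ z₅ + (((qs N).filter fun q ↦ q ≠ 1).map
      fun q : ℕ ↦ (q : ℂ) ^ (-s) * G N q z₂ z₃ z₅).sum‖) hR
    linarith [norm_le_norm_add_norm_sub' (G N 1 z₂ z₃ z₅) ((((qs N).filter fun q ↦ q ≠ 1).map
      fun q : ℕ ↦ (q : ℂ) ^ (-s) * G N q z₂ z₃ z₅).sum), norm_sub_le_norm_add (G N 1 z₂ z₃ z₅)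
      ((((qs N).filter fun q ↦ q ≠ 1).map fun q : ℕ ↦ (q : ℂ) ^ (-s) * G N q z₂ z₃ z₅).sum)]
  -- `z_p = p^{-s}` and the identity
  have hz : ∀ p : ℕ, 0 < p → (p : ℂ) ^ (-s) = zOf p σ (-(s.im * Real.log p)) :=
    fun p hp ↦ natCast_cpow_neg_eq_zOf p hp s
  have hz2 : (2 : ℂ) ^ (-s) = zOf 2 σ (-(s.im * Real.log 2)) := by exact_mod_cast hz 2 two_pos
  have hz3 : (3 : ℂ) ^ (-s) = zOf 3 σ (-(s.im * Real.log 3)) := by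
    exact_mod_cast hz 3 (by norm_num)
  have hz5 : (5 : ℂ) ^ (-s) = zOf 5 σ (-(s.im * Real.log 5)) := by
    exact_mod_cast hz 5 (by norm_num)
  have hid := zetaPartialSum_eq_sum_G hN s
  rw [hz2, hz3, hz5] at hid
  have hlow := hsplit (zOf 2 σ (-(s.im * Real.log 2))) (zOf 3 σ (-(s.im * Real.log 3)))
    (zOf 5 σ (-(s.im * Real.log 5)))
  rw [← hid] at hlow
  have hcl := hC.extend hs h2.le (-(s.im * Real.log 2)) (-(s.im * Real.log 3))
    (-(s.im * Real.log 5))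
  intro h0
  rw [h0, norm_zero] at hlow
  linarith

/-! ## Link with the general decomposition of `TuranPartialSumsCriterion.lean`

The decomposition of a section along its free primes is proved in full generality in
`TuranPartialSumsCriterion.lean` (`twistedPartialSum_decomposition`: any `N`, any set `S` of primes
containing every `p` with `p² ≤ N`, with `freePrimes N S`, the smooth part `smoothSum N S ω σ` and
the coefficients `bigCoeff N ω q σ` of the free phases). For `10 ≤ N ≤ 28` one has
`{p prime : p² ≤ N} = coreSet N` (`{2, 3}`, or `{2, 3, 5}` from `N = 25` on) and
`freePrimes N (coreSet N) = qs N ∖ {1}`. The list data above is the COMPUTABLE form of the same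
objects that the certificate evaluates (compiled, `TuranPartialSumsBoxCert.lean`); the two
vocabularies are bridged by `G_one_eq_smoothSum` (`G_{N,1}` at `z_p = p^{-σ} e^{iθ_p}` is the smooth
part for the prime phases `ω(p) = e^{iθ_p}`) and `cpow_mul_G_eq_bigCoeff` (`q^{-σ} G_{N,q}` is the
coefficient `c_q(σ)`), so that `R N σ z = Σ_{q free} |c_q(σ)|`. -/

/-- The core primes as a finset: `{2, 3}`, or `{2, 3, 5}` when `25 ≤ N` (for `10 ≤ N ≤ 28` these
are exactly the primes `p` with `p² ≤ N`). [cite: PlattTrudgian2016, §2.2] -/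
def coreSet (N : ℕ) : Finset ℕ := if 25 ≤ N then {2, 3, 5} else {2, 3}

/-- The prime phases of a point of the torus: `ω(2) = e^{iθ₂}`, `ω(3) = e^{iθ₃}`, `ω(5) = e^{iθ₅}`
(and `1` at the other primes, where it is not used). [cite: PlattTrudgian2016, §2.2] -/
noncomputable def twist (θ₂ θ₃ θ₅ : ℝ) (p : ℕ) : ℂ :=
  if p = 2 then cexp (θ₂ * I) else if p = 3 then cexp (θ₃ * I) else if p = 5 then cexp (θ₅ * I)
  else 1

/-- `a_ω(2^a 3^b 5^c) = ω(2)^a ω(3)^b ω(5)^c` for the completely multiplicative extension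
`complMul`. [folklore] -/
theorem complMul_twist_smooth (θ₂ θ₃ θ₅ : ℝ) (t : Term) :
    complMul (twist θ₂ θ₃ θ₅) t.smooth =
      cexp (θ₂ * I) ^ t.a * cexp (θ₃ * I) ^ t.b * cexp (θ₅ * I) ^ t.c := by
  rw [Term.smooth, map_mul, map_mul, complMul_prime_pow _ Nat.prime_two,
    complMul_prime_pow _ Nat.prime_three, complMul_prime_pow _ Nat.prime_five]
  simp [twist]

/-- `mono_t` at `z_p = p^{-σ} e^{iθ_p}` is `a_ω(n') · n'^{-σ}`, `n' = 2^a 3^b 5^c`. [folklore] -/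
theorem mono_zOf_eq_complMul (t : Term) (σ θ₂ θ₃ θ₅ : ℝ) :
    t.mono (zOf 2 σ θ₂) (zOf 3 σ θ₃) (zOf 5 σ θ₅) =
      complMul (twist θ₂ θ₃ θ₅) t.smooth * ((t.smooth : ℕ) : ℂ) ^ (-(σ : ℂ)) := by
  have hz : ∀ p : ℕ, ∀ θ : ℝ, zOf p σ θ = (p : ℂ) ^ (-(σ : ℂ)) * cexp (θ * I) := fun p θ ↦ by
    rw [zOf, Complex.ofReal_cpow (Nat.cast_nonneg p)]
    push_cast
    rfl
  have hsplit : ((t.smooth : ℕ) : ℂ) ^ (-(σ : ℂ)) =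
      t.mono ((2 : ℂ) ^ (-(σ : ℂ))) ((3 : ℂ) ^ (-(σ : ℂ))) ((5 : ℂ) ^ (-(σ : ℂ))) := by
    have := natCast_term_cpow ⟨1, t.a, t.b, t.c⟩ (σ : ℂ)
    simp only [Term.n, one_mul, Nat.cast_one, one_cpow] at this
    exact this
  rw [complMul_twist_smooth, hsplit, Term.mono, Term.mono, hz, hz, hz]
  push_cast
  ring

/-- The cofactors are coprime to the core primes (`n ≤ 28`). [folklore] -/
theorem termOf_q_coprime : ∀ n ∈ List.range' 1 28, ∀ b : Bool,
    ¬ 2 ∣ (termOf b n).q ∧ ¬ 3 ∣ (termOf b n).q ∧ (b = true → ¬ 5 ∣ (termOf b n).q) := by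
  decide

/-- **Smoothness = unit cofactor**: for `n ≤ N ≤ 28`, `n` is `coreSet N`-smooth iff its cofactor
is `1`. [folklore] -/
theorem q_eq_one_iff {N n : ℕ} (hN : N ≤ 28) (hn : n ∈ List.range' 1 N) :
    (termOf (core5 N) n).q = 1 ↔ n.primeFactors ⊆ coreSet N := by
  have hn' : n ∈ List.range' 1 28 := by rw [List.mem_range'_1] at hn ⊢; omega
  have hdec : (termOf (core5 N) n).q * (termOf (core5 N) n).smooth = n := termOf_n n hn' (core5 N)
  have hc0 : core5 N = false → (termOf (core5 N) n).c = 0 := fun h ↦ by simp [termOf, h]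
  rw [List.mem_range'_1] at hn
  constructor
  · intro hq
    rw [hq, one_mul] at hdec
    intro p hp
    rw [Nat.mem_primeFactors] at hp
    obtain ⟨hpp, hpn, -⟩ := hp
    rw [← hdec, Term.smooth] at hpn
    have h235 : p = 2 ∨ p = 3 ∨ (p = 5 ∧ (termOf (core5 N) n).c ≠ 0) := by
      rcases (Nat.Prime.dvd_mul hpp).1 hpn with h | h
      · rcases (Nat.Prime.dvd_mul hpp).1 h with h | h
        · exact Or.inl ((Nat.prime_dvd_prime_iff_eq hpp Nat.prime_two).1 (hpp.dvd_of_dvd_pow h))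
        · exact Or.inr (Or.inl
            ((Nat.prime_dvd_prime_iff_eq hpp Nat.prime_three).1 (hpp.dvd_of_dvd_pow h)))
      · refine Or.inr (Or.inr ⟨(Nat.prime_dvd_prime_iff_eq hpp Nat.prime_five).1
          (hpp.dvd_of_dvd_pow h), ?_⟩)
        rintro hc
        rw [hc, pow_zero, Nat.dvd_one] at h
        exact hpp.one_lt.ne' h
    rw [coreSet]
    rcases h235 with rfl | rfl | ⟨rfl, hc⟩
    · split_ifs <;> simp
    · split_ifs <;> simp
    · have h5 : core5 N = true := by
        by_contra h
        exact hc (hc0 (by simpa using h))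
      have : 25 ≤ N := by simpa [core5] using h5
      rw [if_pos this]; simp
  · intro hsub
    obtain ⟨h2, h3, h5⟩ := termOf_q_coprime n hn' (core5 N)
    have hq1 : 1 ≤ (termOf (core5 N) n).q := (mem_terms hN (List.mem_map.2 ⟨n,
      List.mem_range'_1.2 hn, rfl⟩)).2.2.1
    have hqd : (termOf (core5 N) n).q ∣ n := ⟨_, hdec.symm⟩
    have hqs : (termOf (core5 N) n).q.primeFactors ⊆ coreSet N :=
      (Nat.primeFactors_mono hqd (by omega)).trans hsub
    by_contra hne
    obtain ⟨p, hp⟩ := ((Nat.nonempty_primeFactors (n := (termOf (core5 N) n).q)).2 (by omega)).exists_mem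
    have hpq := Nat.dvd_of_mem_primeFactors hp
    have hpc := hqs hp
    rw [coreSet] at hpc
    split_ifs at hpc with h25
    · simp only [Finset.mem_insert, Finset.mem_singleton] at hpc
      rcases hpc with rfl | rfl | rfl
      · exact h2 hpq
      · exact h3 hpq
      · exact h5 (by simp [core5, h25]) hpq
    · simp only [Finset.mem_insert, Finset.mem_singleton] at hpc
      rcases hpc with rfl | rfl
      · exact h2 hpq
      · exact h3 hpq

/-- Sum over a filtered list as a sum of `ite`s. [folklore] -/
theorem list_sum_map_filter {α M : Type*} [AddCommMonoid M] (l : List α) (p : α → Bool)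
    (f : α → M) : ((l.filter p).map f).sum = (l.map fun x ↦ if p x then f x else 0).sum := by
  induction l with
  | nil => simp
  | cons x l ih =>
    by_cases hx : p x = true
    · simp [hx, ih]
    · simp [hx, ih]

/-- **Bridge, smooth part**: `G_{N,1}(z(σ, θ)) = smoothSum N (coreSet N) ω σ` with
`ω(p) = e^{iθ_p}` (`N ≤ 28`). [cite: PlattTrudgian2016, §2.2] -/
theorem G_one_eq_smoothSum {N : ℕ} (hN : N ≤ 28) (σ θ₂ θ₃ θ₅ : ℝ) :
    G N 1 (zOf 2 σ θ₂) (zOf 3 σ θ₃) (zOf 5 σ θ₅) = smoothSum N (coreSet N) (twist θ₂ θ₃ θ₅) σ := by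
  rw [smoothSum, Finset.sum_filter, Nat.Icc_eq_range', Nat.add_sub_cancel, Finset.sum_mk,
    Multiset.map_coe, Multiset.sum_coe, G, terms, List.filter_map, List.map_map,
    list_sum_map_filter]
  refine congrArg List.sum (List.map_congr_left fun n hn ↦ ?_)
  simp only [Function.comp, decide_eq_true_eq]
  by_cases hq : (termOf (core5 N) n).q = 1
  · have hs := (q_eq_one_iff hN hn).1 hq
    rw [if_pos hq, if_pos hs, mono_zOf_eq_complMul]
    have hn' : n ∈ List.range' 1 28 := by rw [List.mem_range'_1] at hn ⊢; omega
    have hdec : (termOf (core5 N) n).q * (termOf (core5 N) n).smooth = n := termOf_n n hn' _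
    rw [hq, one_mul] at hdec
    rw [hdec]
  · rw [if_neg hq, if_neg (fun h ↦ hq ((q_eq_one_iff hN hn).2 h))]

/-- The core parts of the terms of cofactor `q ≠ 1` are `1, …, ⌊N/q⌋` (`N ≤ 28`). [folklore] -/
theorem smooth_of_group : ∀ N ∈ List.range' 1 28, ∀ q ∈ qs N, q ≠ 1 →
    ((terms N).filter fun t ↦ t.q = q).map Term.smooth = List.range' 1 (N / q) := by
  decide

/-- **Bridge, free coefficients**: `q^{-σ} G_{N,q}(z(σ, θ)) = bigCoeff N ω q σ` for a cofactor
`q ≠ 1` of `ζ_N` (`N ≤ 28`); hence `R N σ z = Σ_q |c_q(σ)|`. [cite: PlattTrudgian2016, §2.2] -/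
theorem cpow_mul_G_eq_bigCoeff {N : ℕ} (hN1 : 1 ≤ N) (hN : N ≤ 28) {q : ℕ} (hq : q ∈ qs N)
    (hq1 : q ≠ 1) (σ θ₂ θ₃ θ₅ : ℝ) :
    (q : ℂ) ^ (-(σ : ℂ)) * G N q (zOf 2 σ θ₂) (zOf 3 σ θ₃) (zOf 5 σ θ₅) =
      bigCoeff N (twist θ₂ θ₃ θ₅) q σ := by
  have hl := smooth_of_group N (by rw [List.mem_range'_1]; omega) q hq hq1
  rw [bigCoeff, Nat.Icc_eq_range', Nat.add_sub_cancel, Finset.sum_mk, Multiset.map_coe,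
    Multiset.sum_coe, ← hl, List.map_map, G, ← List.sum_map_mul_left]
  refine congrArg List.sum (List.map_congr_left fun t _ ↦ ?_)
  simp only [Function.comp]
  rw [mono_zOf_eq_complMul, Nat.cast_mul, natCast_mul_natCast_cpow]
  ring

end BoxCert

end Literature.Barriers.RiemannHypothesis
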